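import Literature.NumberTheory.Sieve.MontgomeryVaughan1975MajorArcs
import Literature.NumberTheory.LFunctions.ZetaZeroFreeRegion
import Literature.NumberTheory.LFunctions.GranvilleMollinLinnikZeros
import HarnessLib

/-!
# Montgomery–Vaughan (1975), Lemma 4.1 in the box `|γ| ≤ P^A`: zeros near `σ = 1` are the
exceptional zero, `ζ` has none, and the exceptional zero is simple — PROVED

H. L. Montgomery, R. C. Vaughan, *The exceptional set in Goldbach's problem*, Acta Arith. 27
(1975) 353–370 [MontgomeryVaughanActa1975], §4, Lemma 4.1 (p. 356–357: "There is a `c₁ > 0` such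
that `L(σ, χ) ≠ 0` for `σ ≥ 1 − c₁/log P` and all primitive `χ` (mod `q`), `q ≤ P`, with the
possible exception of at most one primitive character `χ̃` … established by Davenport §14") and
its use in Lemma 4.3 (p. 358: Gallagher's Theorem 7 "with `T = P⁶`", i.e. the zeros `ρ = β + iγ`,
`|γ| ≤ T`, of the `L(s, χ)`, `χ` primitive mod `q ≤ P`, other than `β̃`, all have
`β ≤ 1 − c₁/log P`).

The tree PROVES the classical zero-free regions — Montgomery–Vaughan I, Theorem 11.3 for
`L(s, χ)`, `χ ≠ χ₀` (`Literature.NumberTheory.LFunctions.DirichletZFR.exists_zeroFree`: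
a zero with `β > 1 − c/(log q + log(|γ| + 4))` is real and `χ` is quadratic), Theorem 6.6 for `ζ`
(`Literature.NumberTheory.LFunctions.classicalZFRData_riemannZeta` with `ClassicalZFRData.zeroFree`),
the multiplicity clause of Theorem 11.3 (`exists_deriv_ne_zero_of_realZero`,
`ExceptionalZeroSimple.lean`) and Page's theorem in M–V's currency (`exists_exceptionalZero_unique`,
`lemma41At_of_lt`). This file draws the consequences in the box `q ≤ P`, `|γ| ≤ P^A` (`A ≥ 1`;
M–V: `A = 6`), where `log q + log(|γ| + 4) ≤ (A + 3) log P`, in the currency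
`IsExceptionalZero c₀ P q χ β` of `MontgomeryVaughan1975MajorArcs.lean`:

* `exists_boxZero_real_quadratic`, `exists_boxZero_isExceptional` — there is an absolute `c > 0`
  such that for `c₀ (A + 3) ≤ c`, `P ≥ 2`, every zero `ρ` of `L(s, χ)` (`χ ≠ χ₀` mod `q ≤ P`) with
  `|Im ρ| ≤ P^A` and `Re ρ > 1 − c₀/log P` is real, `χ` is quadratic, and (for primitive `χ`)
  `(q, χ, Re ρ)` is an exceptional datum at level `c₀`; contrapositive `boxZero_re_le`;
* `exists_zeta_no_boxZero` — `ζ` has no zero with `|Im ρ| ≤ P^A`, `Re ρ > 1 − c₀/log P`;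
* `exists_isExceptionalZero_simple` — for `c₀` below an absolute constant and `P ≥ 2`, an
  exceptional zero `β̃` is a simple zero of `L(s, χ̃)` (`L'(β̃, χ̃) ≠ 0`, multiplicity
  `DirichletDisc.zeroOrder χ̃ β̃ = 1`);
* `eq_one_of_isPrimitive_one` — the principal character is primitive only mod `1` (so "primitive
  `χ` mod `q ≤ P`" splits into `ζ` and `χ ≠ χ₀`).

Together with `lemma41At_of_lt` (uniqueness of the exceptional datum) this is everything about
the location of zeros that the derivation of Lemma 4.3 from a log-free zero-density estimate
(Gallagher 1970, §5) consumes. No named facts.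

## References

* H. L. Montgomery, R. C. Vaughan, Acta Arith. 27 (1975) 353–370, §4 Lemma 4.1, Lemma 4.3
  [MontgomeryVaughanActa1975].
* H. L. Montgomery, R. C. Vaughan, *Multiplicative Number Theory I*, CUP 2007, Theorems 6.6, 11.3
  [MontgomeryVaughan2007].
-/

noncomputable section

open Complex

namespace Literature.NumberTheory.Sieve.MontgomeryVaughan1975

open Literature.NumberTheory.LFunctions Literature.NumberTheory.LFunctions.DirichletZFR
  Literature.NumberTheory.LFunctions.SiegelZero

/-! ### Bookkeeping in the box `q ≤ P`, `|γ| ≤ P^A` -/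

/-- `log(|γ| + 4) ≤ (A + 2) log P` for `|γ| ≤ P^A`, `P ≥ 2`, `A ≥ 1` (`|γ| + 4 ≤ P^A + 4 ≤ P^A P²`).
[folklore] -/
theorem log_abs_add_four_le {P A γ : ℝ} (hP : 2 ≤ P) (hA : 1 ≤ A) (hγ : |γ| ≤ P ^ A) :
    Real.log (|γ| + 4) ≤ (A + 2) * Real.log P := by
  have hP0 : 0 < P := by linarith
  have hP1 : 1 ≤ P := by linarith
  have hPA : 2 ≤ P ^ A := by
    calc (2 : ℝ) ≤ P := hP
      _ = P ^ (1 : ℝ) := (Real.rpow_one P).symm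
      _ ≤ P ^ A := Real.rpow_le_rpow_of_exponent_le hP1 hA
  have hsq : 4 ≤ P ^ (2 : ℝ) := by rw [Real.rpow_two]; nlinarith
  have h1 : |γ| + 4 ≤ P ^ (A + 2) := by
    rw [Real.rpow_add hP0]
    have h2 : P ^ A * 4 ≤ P ^ A * P ^ (2 : ℝ) := mul_le_mul_of_nonneg_left hsq (by linarith)
    linarith
  have h0 : 0 < |γ| + 4 := by positivity
  calc Real.log (|γ| + 4) ≤ Real.log (P ^ (A + 2)) := Real.log_le_log h0 h1
    _ = (A + 2) * Real.log P := Real.log_rpow hP0 _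

/-- `log q ≤ log P` for a natural `q ≤ P`, `P ≥ 1` (also for `q = 0`, `log 0 = 0`). [folklore] -/
theorem log_natCast_le {P : ℝ} (hP : 1 ≤ P) {q : ℕ} (hq : (q : ℝ) ≤ P) :
    Real.log q ≤ Real.log P := by
  rcases Nat.eq_zero_or_pos q with h | h
  · subst h
    rw [Nat.cast_zero, Real.log_zero]
    exact Real.log_nonneg hP
  · exact Real.log_le_log (by exact_mod_cast h) hq

/-- In the box: `log q + log(|γ| + 4) ≤ (A + 3) log P`. [folklore] -/
theorem ell_le_of_box {P A : ℝ} (hP : 2 ≤ P) (hA : 1 ≤ A) {q : ℕ} (hq : (q : ℝ) ≤ P) {γ : ℝ}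
    (hγ : |γ| ≤ P ^ A) : Real.log q + Real.log (|γ| + 4) ≤ (A + 3) * Real.log P := by
  have h1 := log_natCast_le (by linarith : (1 : ℝ) ≤ P) hq
  have h2 := log_abs_add_four_le hP hA hγ
  linarith

/-- The comparison of widths: `c₀ (A + 3) ≤ c` and `0 < ℓ ≤ (A + 3) log P` give
`c₀/log P ≤ c/ℓ`. [folklore] -/
theorem div_log_le_div {c c₀ A P ℓ : ℝ} (hc₀ : 0 ≤ c₀) (hcc : c₀ * (A + 3) ≤ c) (hℓ0 : 0 < ℓ)
    (hℓ : ℓ ≤ (A + 3) * Real.log P) (hlogP : 0 < Real.log P) : c₀ / Real.log P ≤ c / ℓ := by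
  rw [div_le_div_iff₀ hlogP hℓ0]
  calc c₀ * ℓ ≤ c₀ * ((A + 3) * Real.log P) := mul_le_mul_of_nonneg_left hℓ hc₀
    _ = c₀ * (A + 3) * Real.log P := by ring
    _ ≤ c * Real.log P := mul_le_mul_of_nonneg_right hcc hlogP.le

/-- The principal character is primitive only modulo `1`. [folklore] -/
theorem eq_one_of_isPrimitive_one {q : ℕ} [NeZero q]
    (h : (1 : DirichletCharacter ℂ q).IsPrimitive) : q = 1 := by
  rw [DirichletCharacter.isPrimitive_def, DirichletCharacter.conductor_one] at h
  exact h.symm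

/-! ### Zeros of `L(s, χ)`, `χ ≠ χ₀`, in the box -/

/-- **MV I Theorem 11.3 in the box** (the content of M–V 1975 Lemma 4.1 for `L(s, χ)`, `χ ≠ χ₀`):
there is an absolute `c > 0` such that for `A ≥ 1`, `0 < c₀`, `c₀(A + 3) ≤ c`, `P ≥ 2`, every
zero `ρ` of `L(s, χ)`, `χ ≠ χ₀` mod `q ≤ P`, with `|Im ρ| ≤ P^A` and `Re ρ > 1 − c₀/log P` is REAL,
`χ` is QUADRATIC, `Re ρ < 1` and `L(Re ρ, χ) = 0`. (In the box `log q + log(|γ|+4) ≤ (A+3) log P`,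
so `1 − c/(log q + log(|γ|+4)) ≤ 1 − c₀/log P`.)
[cite: MontgomeryVaughan2007, Theorem 11.3] [cite: MontgomeryVaughanActa1975, §4 Lemma 4.1] -/
theorem exists_boxZero_real_quadratic :
    ∃ c : ℝ, 0 < c ∧ ∀ A : ℝ, 1 ≤ A → ∀ c₀ P : ℝ, 0 < c₀ → c₀ * (A + 3) ≤ c → 2 ≤ P →
      ∀ (q : ℕ) [NeZero q] (χ : DirichletCharacter ℂ q), χ ≠ 1 → (q : ℝ) ≤ P →
        ∀ ρ : ℂ, χ.LFunction ρ = 0 → |ρ.im| ≤ P ^ A → 1 - c₀ / Real.log P < ρ.re →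
          ρ.im = 0 ∧ χ ^ 2 = 1 ∧ ρ.re < 1 ∧ χ.LFunction (ρ.re : ℂ) = 0 := by
  obtain ⟨c, hc, hZ⟩ := exists_zeroFree
  refine ⟨c, hc, fun A hA c₀ P hc₀ hcc hP q _ χ hχ hq ρ hρ hγ hre => ?_⟩
  have hlogP : 0 < Real.log P := Real.log_pos (by linarith)
  set ℓ : ℝ := Real.log q + Real.log (|ρ.im| + 4) with hℓdef
  have hℓ1 : 1 ≤ ℓ := one_le_ell q ρ.im
  have hℓ : ℓ ≤ (A + 3) * Real.log P := ell_le_of_box hP hA hq hγ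
  have hdiv : c₀ / Real.log P ≤ c / ℓ := div_log_le_div hc₀.le hcc (by linarith) hℓ hlogP
  have hreg : 1 - c / ℓ < ρ.re := by linarith
  obtain ⟨hquad, him⟩ := hZ q χ hχ ρ hρ hreg
  have hre1 : ρ.re < 1 := by
    by_contra hcon
    exact DirichletCharacter.LFunction_ne_zero_of_one_le_re χ (Or.inl hχ) (not_lt.mp hcon) hρ
  have hρeq : ((ρ.re : ℝ) : ℂ) = ρ := by
    apply Complex.ext
    · simp
    · simp [him]
  refine ⟨him, hquad, hre1, ?_⟩
  rw [hρeq]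
  exact hρ

/-- **Zeros in the box are exceptional data** (M–V 1975, Lemma 4.1 as used in Lemma 4.3 with
`T = P⁶`): with the absolute `c` of `exists_boxZero_real_quadratic`, for `A ≥ 1`, `c₀(A+3) ≤ c`,
`P ≥ 2`, a zero `ρ` of `L(s, χ)` (`χ ≠ χ₀` primitive mod `q ≤ P`) with `|Im ρ| ≤ P^A` and
`Re ρ > 1 − c₀/log P` is real, `χ` is quadratic, and `(q, χ, Re ρ)` is exceptional at level `c₀`
(`IsExceptionalZero c₀ P q χ ρ.re`); by `lemma41At_of_lt` such a datum is unique for small `c₀`.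
[cite: MontgomeryVaughanActa1975, §4 Lemma 4.1] -/
theorem exists_boxZero_isExceptional :
    ∃ c : ℝ, 0 < c ∧ ∀ A : ℝ, 1 ≤ A → ∀ c₀ P : ℝ, 0 < c₀ → c₀ * (A + 3) ≤ c → 2 ≤ P →
      ∀ (q : ℕ) [NeZero q] (χ : DirichletCharacter ℂ q), χ.IsPrimitive → χ ≠ 1 → (q : ℝ) ≤ P →
        ∀ ρ : ℂ, χ.LFunction ρ = 0 → |ρ.im| ≤ P ^ A → 1 - c₀ / Real.log P < ρ.re →
          ρ.im = 0 ∧ χ ^ 2 = 1 ∧ IsExceptionalZero c₀ P q χ ρ.re := by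
  obtain ⟨c, hc, H⟩ := exists_boxZero_real_quadratic
  refine ⟨c, hc, fun A hA c₀ P hc₀ hcc hP q _ χ hprim hχ hq ρ hρ hγ hre => ?_⟩
  obtain ⟨him, hquad, hre1, hL⟩ := H A hA c₀ P hc₀ hcc hP q χ hχ hq ρ hρ hγ hre
  exact ⟨him, hquad, hprim, hχ, hq, hre.le, hre1, hL⟩

/-- **Contrapositive**: with the same absolute `c`, a zero in the box that is NOT (real and) the
exceptional datum of its character satisfies `Re ρ ≤ 1 − c₀/log P`; in particular every zero in
the box of a character admitting no exceptional zero at level `c₀`.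
[cite: MontgomeryVaughanActa1975, §4 Lemma 4.1] -/
theorem exists_boxZero_re_le :
    ∃ c : ℝ, 0 < c ∧ ∀ A : ℝ, 1 ≤ A → ∀ c₀ P : ℝ, 0 < c₀ → c₀ * (A + 3) ≤ c → 2 ≤ P →
      ∀ (q : ℕ) [NeZero q] (χ : DirichletCharacter ℂ q), χ.IsPrimitive → χ ≠ 1 → (q : ℝ) ≤ P →
        ∀ ρ : ℂ, χ.LFunction ρ = 0 → |ρ.im| ≤ P ^ A →
          ¬ (ρ.im = 0 ∧ IsExceptionalZero c₀ P q χ ρ.re) → ρ.re ≤ 1 - c₀ / Real.log P := by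
  obtain ⟨c, hc, H⟩ := exists_boxZero_isExceptional
  refine ⟨c, hc, fun A hA c₀ P hc₀ hcc hP q _ χ hprim hχ hq ρ hρ hγ hnot => ?_⟩
  by_contra hcon
  obtain ⟨him, -, hEZ⟩ := H A hA c₀ P hc₀ hcc hP q χ hprim hχ hq ρ hρ hγ (not_le.mp hcon)
  exact hnot ⟨him, hEZ⟩

/-! ### `ζ` has no zeros in the box -/

/-- **MV I Theorem 6.6 in the box** (the case `q = 1` of M–V 1975 Lemma 4.1): there is an absolute
`c > 0` such that for `A ≥ 1`, `0 < c₀`, `c₀(A + 3) ≤ c`, `P ≥ 2`, every zero `ρ` of `ζ` with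
`|Im ρ| ≤ P^A` has `Re ρ ≤ 1 − c₀/log P`. (`c ≤ 1` forces `c₀/log P < 1/2`, so the region lies in
`σ > 1/2` where `ζ₁ = (s − 1)ζ(s)` is zero-free up to `1 − c/log(|t| + 4)`; `ρ ≠ 1` as `ζ(1) ≠ 0`
in Mathlib's normalisation, indeed `ζ ≠ 0` on `σ ≥ 1`.)
[cite: MontgomeryVaughan2007, Theorem 6.6] [cite: MontgomeryVaughanActa1975, §4 Lemma 4.1] -/
theorem exists_zeta_no_boxZero :
    ∃ c : ℝ, 0 < c ∧ ∀ A : ℝ, 1 ≤ A → ∀ c₀ P : ℝ, 0 < c₀ → c₀ * (A + 3) ≤ c → 2 ≤ P →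
      ∀ ρ : ℂ, riemannZeta ρ = 0 → |ρ.im| ≤ P ^ A → ρ.re ≤ 1 - c₀ / Real.log P := by
  obtain ⟨c, hc, hζ⟩ := classicalZFRData_riemannZeta.zeroFree
  refine ⟨min c 1, lt_min hc one_pos, fun A hA c₀ P hc₀ hcc hP ρ hρ hγ => ?_⟩
  by_contra hcon
  have hre : 1 - c₀ / Real.log P < ρ.re := not_le.mp hcon
  have hlogP : 0 < Real.log P := Real.log_pos (by linarith)
  have hlog2 : (1 / 2 : ℝ) < Real.log P := by
    have h2 : Real.log 2 ≤ Real.log P := Real.log_le_log two_pos hP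
    have := Real.log_two_gt_d9
    linarith
  -- `c₀ ≤ 1/4`, so `c₀/log P < 1/2` and the zero lies in `σ > 1/2`
  have hc₀4 : c₀ ≤ 1 / 4 := by
    have h1 : c₀ * (A + 3) ≤ 1 := hcc.trans (min_le_right _ _)
    nlinarith
  have hhalf : 1 - 1 / 2 < ρ.re := by
    have : c₀ / Real.log P < 1 / 2 := by
      rw [div_lt_iff₀ hlogP]; nlinarith
    linarith
  set ℓ : ℝ := Real.log (|ρ.im| + 4) with hℓdef
  have hℓ1 : 1 ≤ ℓ := by
    have h4 : Real.log 4 ≤ ℓ := Real.log_le_log (by norm_num) (by linarith [abs_nonneg ρ.im])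
    have : (1 : ℝ) ≤ Real.log 4 := by
      rw [← Real.log_exp 1]
      refine Real.log_le_log (Real.exp_pos 1) ?_
      have := Real.exp_one_lt_d9
      linarith
    linarith
  have hℓ : ℓ ≤ (A + 3) * Real.log P := by
    have := log_abs_add_four_le hP hA hγ
    nlinarith
  have hdiv : c₀ / Real.log P ≤ c / ℓ :=
    div_log_le_div hc₀.le (hcc.trans (min_le_left _ _)) (by linarith) hℓ hlogP
  have hreg : 1 - c / ℓ < ρ.re := by linarith
  have hne1 : ρ ≠ 1 := by
    rintro rfl
    exact riemannZeta_ne_zero_of_one_le_re (by simp) hρ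
  exact hζ ρ hhalf hreg ((riemannZeta₁_eq_zero_iff hne1).mpr hρ)

/-- The same for the `L`-function of the (primitive, principal) character modulo `1`, which is
`ζ` (`DirichletCharacter.LFunction_modOne_eq`). [cite: MontgomeryVaughanActa1975, §4 Lemma 4.1] -/
theorem exists_modOne_no_boxZero :
    ∃ c : ℝ, 0 < c ∧ ∀ A : ℝ, 1 ≤ A → ∀ c₀ P : ℝ, 0 < c₀ → c₀ * (A + 3) ≤ c → 2 ≤ P →
      ∀ (χ : DirichletCharacter ℂ 1) (ρ : ℂ), χ.LFunction ρ = 0 → |ρ.im| ≤ P ^ A →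
        ρ.re ≤ 1 - c₀ / Real.log P := by
  obtain ⟨c, hc, H⟩ := exists_zeta_no_boxZero
  refine ⟨c, hc, fun A hA c₀ P hc₀ hcc hP χ ρ hρ hγ => H A hA c₀ P hc₀ hcc hP ρ ?_ hγ⟩
  rwa [DirichletCharacter.LFunction_modOne_eq] at hρ

/-! ### The exceptional zero is simple -/

/-- **The exceptional zero is simple** (MV I Theorem 11.3, multiplicity clause, in M–V 1975's
currency): there is an absolute `c > 0` such that for `0 < c₀ < c` and `P ≥ 2`, every exceptional
datum `(r̃, χ̃, β̃)` at level `c₀` (`IsExceptionalZero c₀ P r̃ χ̃ β̃`) has `L'(β̃, χ̃) ≠ 0`, i.e.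
`β̃` is a zero of multiplicity one (`DirichletDisc.zeroOrder χ̃ β̃ = 1`). (`log r̃ + log 4 ≤ 3 log P`,
so `1 − c'/(log r̃ + log 4) < 1 − c₀/log P ≤ β̃` for `3c₀ < c'`, `c'` the constant of
`exists_deriv_ne_zero_of_realZero`.) This is what lets Gallagher's Theorem 7 remove the single
term `x^{β̃}/β̃` from the explicit formula of `χ̃`.
[cite: MontgomeryVaughan2007, Theorem 11.3] [cite: MontgomeryVaughanActa1975, §4 Lemma 4.1] -/
theorem exists_isExceptionalZero_simple :
    ∃ c : ℝ, 0 < c ∧ ∀ c₀ P : ℝ, 0 < c₀ → c₀ < c → 2 ≤ P →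
      ∀ (q : ℕ) [NeZero q] (χ : DirichletCharacter ℂ q) (β : ℝ), IsExceptionalZero c₀ P q χ β →
        deriv χ.LFunction β ≠ 0 ∧ DirichletDisc.zeroOrder χ β = 1 := by
  obtain ⟨c, hc, hS⟩ := exists_deriv_ne_zero_of_realZero
  refine ⟨c / 3, by positivity, fun c₀ P hc₀ hlt hP q _ χ β hEZ => ?_⟩
  obtain ⟨_, hne, hq, hβ, _, hzero⟩ := hEZ
  have hlogP : 0 < Real.log P := Real.log_pos (by linarith)
  have hℓ : Real.log q + Real.log 4 ≤ 3 * Real.log P := by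
    have h1 := log_natCast_le (by linarith : (1 : ℝ) ≤ P) hq
    have h2 : Real.log 4 ≤ 2 * Real.log P := by
      rw [show (4 : ℝ) = 2 ^ 2 by norm_num, Real.log_pow, Nat.cast_ofNat]
      linarith [Real.log_le_log two_pos hP]
    linarith
  have hℓ0 : 0 < Real.log q + Real.log 4 := by
    have : 0 ≤ Real.log (q : ℝ) := Real.log_natCast_nonneg q
    have : 0 < Real.log (4 : ℝ) := Real.log_pos (by norm_num)
    linarith
  have hdiv : c₀ / Real.log P < c / (Real.log q + Real.log 4) := by
    rw [div_lt_div_iff₀ hlogP hℓ0]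
    calc c₀ * (Real.log q + Real.log 4) ≤ c₀ * (3 * Real.log P) :=
          mul_le_mul_of_nonneg_left hℓ hc₀.le
      _ = (3 * c₀) * Real.log P := by ring
      _ < c * Real.log P := mul_lt_mul_of_pos_right (by linarith) hlogP
  have hβ' : 1 - c / (Real.log q + Real.log 4) < β := by linarith
  have hd : deriv χ.LFunction β ≠ 0 := hS q χ hne β hzero hβ'
  exact ⟨hd, zeroOrder_eq_one_of_deriv_ne_zero hne hzero hd⟩

end Literature.NumberTheory.Sieve.MontgomeryVaughan1975
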